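import Summits.ResolutionOfSingularities.ResolutionOfSingularities.Theorems.EquisingularLiftEquisingularLiftNatClusterPointCover
import HarnessLib

/-!
# [OURS · L1 W4.5(b) · EL♮(3)] (δ) D3 POINT-DICT, part 3 (D3d GOOD CHART): a point of the exceptional divisor that is NOT one of the
# `S`-cluster points reads on a chart where it is none of D1's excluded coordinate points

Crux chain w45b (cell `res-hironaka`, slot W4.5(b)), working crux **EL♮** = stmt-ResolutionOfSingularities-20038, child **EL♮(3)** =
stmt-ResolutionOfSingularities-20148, route EquisingularLift, line `sections`, registered stub `stub_elnat_tcPlusPlusPointResolution` (v2);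
brick **(δ) D3 POINT-DICT** (res-L1-w45b-plan-1 DE-COLLISION 2026-08-27T17:03:18Z: D3 whole := res-type-100; D3d = the input of Member
clause (v) of D5). HONEST FRAMING: OURS; NOT a statement of any manuscript; AI-written, weaker than expert review. No `sorry`; standard axioms.
DEF-FREE. `--supports stmt-ResolutionOfSingularities-20148 --as helper`.

WHY. res-L1-w45b-stub-3's D1 cone `Φ_S` (p548257) is Δ-regular on the chart `T_l = 1` at every prime over `ϖ` EXCEPT the point ideals of the
cluster members `t` visible there with `t ∈ S` or `i t ≠ l`. Member clause (v) needs, at every special point `z = j₂ w` off the `S`-points, a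
chart `l` on which `w` is visible and is none of those excluded coordinate points — the `hnot` input of res-type-100's
`isRegularLocalRing_quotient_carrierDelta_of_goodChart` (…NatCarrierDeltaOffCluster).

WHAT (namespace `…Cruxes.EquisingularLiftNat.Sections`).
* **`exists_goodChart_of_forall_ne_clusterPoint`** — cluster points `y′ t` with their chart-`i t` presentations and coordinates (parts 1/2b),
  the DISTINCT clause of `FatCluster`, a subset `S`, and a point `w` over `x` with `w ≠ y′ t` for `t ∈ S` ⟹ a chart `l` with a presentation
  `(𝔔, χ)` of `𝒪_{F₂,w}` such that for every member `t` visible on `l` (`â_t l ≠ 0`) with `t ∈ S ∨ i t ≠ l` and every lift `b` of `â_t/â_t l`: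
  `¬ ∀ l′, c̄_l′/c̄_l − b_l′ ∈ 𝔔`. CASES: if `w = y′ t₀` (then `t₀ ∉ S`) read on `l = i t₀` with `y′ t₀`'s own presentation — a second member
  `t ≠ t₀` with the same chart-`l` coordinates would be proportional to `t₀` (DISTINCT); otherwise any chart — a member's coordinates would
  force `w = y′ t` (part 2b `eq_clusterPoint_of_forall_frac_sub_mem`).

References: parts 1/2a/2b (…NatClusterPointDict p551356, …ChartChange p552421, …Cover); res-L1-w45b-stub-2 T-PTPRIME-DICT (p540294);
The Stacks Project, Tag 0804 [cite: StacksProject, Tag 0804].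
-/

set_option linter.dupNamespace false -- mandated namespace `Summit.<Summit>.<Problem>` of this single-conjunct summit

noncomputable section

open CategoryTheory CategoryTheory.Limits AlgebraicGeometry TopologicalSpace IsLocalRing
open Literature.AlgebraicGeometry.Resolution
open AlgebraicGeometry.Scheme.IdealSheafData

namespace Summit.ResolutionOfSingularities.ResolutionOfSingularities.Cruxes.EquisingularLiftNat.Sections

variable {F₁ F₂ : Scheme.{0}} {υ : F₂ ⟶ F₁} {x : F₁}

set_option maxHeartbeats 800000 in -- subalgebra-of-localisation instances are slow (cf. p526020)
/-- **(D3d) THE GOOD CHART of a point off the `S`-cluster points** (see the module docstring). [cite: StacksProject, Tag 0804]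
[OURS · L1 W4.5b] (δ) D3 POINT-DICT; NOT a statement of the manuscript. -/
theorem exists_goodChart_of_forall_ne_clusterPoint (hx : IsClosed ({x} : Set F₁))
    (hυ : IsBlowup υ (vanishingIdeal ⟨{x}, hx⟩))
    (c : Fin 3 → F₁.presheaf.stalk x) (hc𝔪 : Ideal.span (Set.range c) = maximalIdeal (F₁.presheaf.stalk x))
    {k' : Type} [Field k'] (πk : F₁.presheaf.stalk x →+* k') (hkerπ : RingHom.ker πk = Ideal.span (Set.range c))
    {s : ℕ} (i : Fin s → Fin 3) (a : (t : Fin s) → {j : Fin 3 // j ≠ i t} → k')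
    (hdist : ∀ t t', t ≠ t' → ¬ ∃ r : k', (fun l : Fin 3 => if h : l = i t' then (1 : k') else a t' ⟨l, h⟩) =
      r • (fun l : Fin 3 => if h : l = i t then (1 : k') else a t ⟨l, h⟩))
    (y' : Fin s → F₂) (hy' : ∀ t, υ (y' t) = x)
    (𝔮p : ∀ t, PrimeSpectrum (blowupAlgebra (Ideal.span (Set.range c)) (c (i t))))
    (χp : ∀ t, blowupAlgebra (Ideal.span (Set.range c)) (c (i t)) →+* F₂.presheaf.stalk (y' t))
    (hχp : ∀ t r, χp t (algebraMap _ _ r) = ((F₁.presheaf.stalkCongr (.of_eq (hy' t))).inv ≫ υ.stalkMap (y' t)).hom r)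
    (hlocp : ∀ t, @IsLocalization.AtPrime _ _ (F₂.presheaf.stalk (y' t)) _ (χp t).toAlgebra (𝔮p t).asIdeal _)
    (h𝔮p : ∀ t, (𝔮p t).asIdeal.comap (algebraMap _ (blowupAlgebra (Ideal.span (Set.range c)) (c (i t)))) =
      maximalIdeal (F₁.presheaf.stalk x))
    (wp : ∀ t, {l : Fin 3 // l ≠ i t} → F₁.presheaf.stalk x) (hwp : ∀ t l, πk (wp t l) = a t l)
    (hfrp : ∀ t (l : {l : Fin 3 // l ≠ i t}), blowupAlgebra.frac c (i t) l.1 - algebraMap _ _ (wp t l) ∈ (𝔮p t).asIdeal)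
    (S : Set (Fin s)) (w : F₂) (hwx : υ w = x) (hwS : ∀ t ∈ S, w ≠ y' t) :
    ∃ (l : Fin 3) (𝔔 : PrimeSpectrum (blowupAlgebra (Ideal.span (Set.range c)) (c l)))
      (χ : blowupAlgebra (Ideal.span (Set.range c)) (c l) →+* F₂.presheaf.stalk w),
      (∀ r, χ (algebraMap _ _ r) = ((F₁.presheaf.stalkCongr (.of_eq hwx)).inv ≫ υ.stalkMap w).hom r) ∧
      @IsLocalization.AtPrime _ _ (F₂.presheaf.stalk w) _ χ.toAlgebra 𝔔.asIdeal _ ∧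
      𝔔.asIdeal.comap (algebraMap _ (blowupAlgebra (Ideal.span (Set.range c)) (c l))) = maximalIdeal (F₁.presheaf.stalk x) ∧
      ∀ t : Fin s, (if h : l = i t then (1 : k') else a t ⟨l, h⟩) ≠ 0 → (t ∈ S ∨ i t ≠ l) →
        ∀ b : {l' : Fin 3 // l' ≠ l} → F₁.presheaf.stalk x,
          (∀ l', πk (b l') = (if h : (l' : Fin 3) = i t then (1 : k') else a t ⟨l', h⟩) /
            (if h : l = i t then (1 : k') else a t ⟨l, h⟩)) →
          ¬ ∀ l' : {l' : Fin 3 // l' ≠ l}, blowupAlgebra.frac c l l'.1 - algebraMap _ _ (b l') ∈ 𝔔.asIdeal := by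
  classical
  have hcJ : Ideal.span (Set.range c) = stalkIdeal (vanishingIdeal ⟨{x}, hx⟩) x := by
    rw [hc𝔪, stalkIdeal_vanishingIdeal_singleton hx]
  by_cases hex : ∃ t₀, w = y' t₀
  · -- `w = y′ t₀`, `t₀ ∉ S`: read on the member's own chart `i t₀`
    obtain ⟨t₀, rfl⟩ := hex
    have ht₀S : t₀ ∉ S := fun h => hwS t₀ h rfl
    refine ⟨i t₀, 𝔮p t₀, χp t₀, hχp t₀, hlocp t₀, h𝔮p t₀, fun t hât htS b hb hall => ?_⟩
    have htt : t₀ ≠ t := by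
      rintro rfl
      rcases htS with h | h
      · exact ht₀S h
      · exact h rfl
    -- the two coordinate vectors agree after `πk`
    have hcoord : ∀ l' : {l' : Fin 3 // l' ≠ i t₀},
        (if h : (l' : Fin 3) = i t then (1 : k') else a t ⟨l', h⟩) / (if h : i t₀ = i t then (1 : k') else a t ⟨i t₀, h⟩) =
          a t₀ l' := by
      intro l'
      have h1 := (𝔮p t₀).asIdeal.sub_mem (hall l') (hfrp t₀ l')
      rw [sub_sub_sub_cancel_left, ← map_sub, ← Ideal.mem_comap, h𝔮p, ← hc𝔪, ← hkerπ, RingHom.mem_ker, map_sub,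
        sub_eq_zero, hwp, hb] at h1
      exact h1.symm
    -- hence `â_t = â_t (i t₀) • â_{t₀}`: excluded by DISTINCT
    refine hdist t₀ t htt ⟨(if h : i t₀ = i t then (1 : k') else a t ⟨i t₀, h⟩), funext fun m => ?_⟩
    rw [Pi.smul_apply, smul_eq_mul]
    by_cases hm : m = i t₀
    · subst hm
      rw [dif_pos rfl, mul_one]
    · rw [dif_neg hm, ← hcoord ⟨m, hm⟩, ← mul_div_assoc, mul_div_cancel_left₀ _ hât]
  · -- `w` is no cluster point: any chart; a member's coordinates would force `w = y′ t`
    push Not at hex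
    obtain ⟨l, 𝔔, χ, hχ, hloc, h𝔔⟩ := exists_chartPresentation_of_eq hυ w hwx c hcJ
    refine ⟨l, 𝔔, χ, hχ, hloc, h𝔔, fun t hât _ b hb hall => hex t ?_⟩
    exact eq_clusterPoint_of_forall_frac_sub_mem hx hυ c hc𝔪 πk hkerπ i a y' hy' 𝔮p χp hχp hlocp h𝔮p wp hwp hfrp t l hât
      w hwx 𝔔 χ hχ hloc h𝔔 b hb hall

end Summit.ResolutionOfSingularities.ResolutionOfSingularities.Cruxes.EquisingularLiftNat.Sections

end
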